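import Summits.CriticalPhenomena.PercolationContinuityZ3.Theorems.PercNearOneGluingNoHeavyLowerTailSunflowerGraphMarkClass
import HarnessLib

/-!
# `NoHeavyLowerTail` (crux stmt-CriticalPhenomena-4575), abstract sunflower cubic: graph-mark sunflowers — proper colourings of bounded degree and
# the MARKED / PENDANT / RAINBOW-TRIANGLE steps of the structured-window induction for ★

Support file (seat `prim-ineq-gen-2` gen 26; `--supports stmt-CriticalPhenomena-4575`).  No `sorry`; nothing is asserted about the crux.
Memo: run/shared/lean/prim/prim-ineq-gen-2/GRAPHMARK-LEAN-GEN26.md.  Part 1 of 3 of the driver (`…GraphMarkSteps`, `…GraphMarkWindowStep`,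
`…GraphMarkMaxDegTwo`): `IsProperEdgeColouring` (symmetric, loopless, proper), `MaxDegLE`, their invariance under recolouring, and the local steps
`marked_step` (Theorem A), `pendant_step` (`ZP_insert_ge_of_pendant`), `triangle_step` (`two_ZP_insert_insert_ge_of_triangleEdge`), each taking
the induction hypothesis `hIH` (★ on every smaller sub-cube of every graph-mark sunflower for the same colouring) as an explicit hypothesis.
-/

namespace Summit.CriticalPhenomena.PercolationContinuityZ3.Theorems.SunflowerPartition

open Finset

variable {α : Type*} [Fintype α] [DecidableEq α]

/-! ## Proper 3-edge-colourings of bounded degree -/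

/-- A (partial) 3-edge-colouring of the pairs of `α` (`none` = no edge): symmetric, loopless and PROPER (no two edges of the same colour at a
vertex). [this work] -/
structure IsProperEdgeColouring (c : α → α → Option (Fin 3)) : Prop where
  /-- symmetry -/
  symm : ∀ x y, c x y = c y x
  /-- no loops -/
  irrefl : ∀ x, c x x = none
  /-- properness -/
  proper : ∀ x y z i, c x y = some i → c x z = some i → y = z

/-- Maximum degree at most `d`. [this work] -/
def MaxDegLE (c : α → α → Option (Fin 3)) (d : ℕ) : Prop :=
  ∀ x, #(univ.filter fun y => (c x y).isSome) ≤ d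

section Colouring

variable {c : α → α → Option (Fin 3)}

omit [Fintype α] [DecidableEq α] in
/-- Recolouring preserves properness. [this work] -/
theorem IsProperEdgeColouring.recolour (hc : IsProperEdgeColouring c) {g : Fin 3 → Fin 3} (hg : Function.Injective g) :
    IsProperEdgeColouring (fun x y => (c x y).map g) where
  symm x y := by simp only [hc.symm x y]
  irrefl x := by simp only [hc.irrefl x, Option.map_none]
  proper x y z i hy hz := by
    obtain ⟨j, hj, hji⟩ := Option.map_eq_some_iff.1 hy
    obtain ⟨j', hj', hj'i⟩ := Option.map_eq_some_iff.1 hz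
    have hjj : j = j' := hg (hji.trans hj'i.symm)
    exact hc.proper x y z j hj (hjj ▸ hj')

omit [DecidableEq α] in
/-- Recolouring preserves degrees. [this work] -/
theorem MaxDegLE.recolour {d : ℕ} (h : MaxDegLE c d) (g : Fin 3 → Fin 3) : MaxDegLE (fun x y => (c x y).map g) d := by
  intro x
  have e : (univ.filter fun y => ((c x y).map g).isSome) = univ.filter fun y => (c x y).isSome := by
    simp only [Option.isSome_map]
  rw [e]
  exact h x

omit [DecidableEq α] in
/-- Degree `≤ 2`: a vertex with two distinct neighbours `a, b` has no third one. [this work] -/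
theorem MaxDegLE.eq_none_of_two (h : MaxDegLE c 2) {x a b : α} (hab : a ≠ b) (ha : (c x a).isSome) (hb : (c x b).isSome)
    {y : α} (hya : y ≠ a) (hyb : y ≠ b) : c x y = none := by
  classical
  by_contra hy
  have hy' : (c x y).isSome := Option.isSome_iff_ne_none.2 hy
  have hsub : ({a, b, y} : Finset α) ⊆ univ.filter fun z => (c x z).isSome := by
    intro z hz
    simp only [mem_insert, mem_singleton] at hz
    rw [mem_filter]
    rcases hz with hz | hz | hz <;> subst hz
    · exact ⟨mem_univ _, ha⟩
    · exact ⟨mem_univ _, hb⟩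
    · exact ⟨mem_univ _, hy'⟩
  have h3 : #({a, b, y} : Finset α) = 3 := by
    rw [card_insert_of_notMem, card_insert_of_notMem, card_singleton]
    · simpa using hyb.symm
    · simp only [mem_insert, mem_singleton, not_or]; exact ⟨hab, hya.symm⟩
  have := card_le_card hsub
  have h2 := h x
  omega

omit [Fintype α] [DecidableEq α] in
/-- An edge has distinct endpoints. [this work] -/
theorem IsProperEdgeColouring.ne_of_some (hc : IsProperEdgeColouring c) {x y : α} {i : Fin 3} (h : c x y = some i) : x ≠ y := by
  rintro rfl
  rw [hc.irrefl] at h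
  exact none_ne_some' i h

end Colouring

namespace Sunflower

variable {F : Sunflower α} {c : α → α → Option (Fin 3)} {T : α → Finset (Fin 3)} {W : Finset α}

/-! ## The local steps of the induction (each takes the induction hypothesis `hIH` for smaller sub-cubes) -/

section Steps

variable (hc : IsProperEdgeColouring c) (hF : F.IsGraphMarkOn c T W)
  (hIH : ∀ (F' : Sunflower α) (T' : α → Finset (Fin 3)) (W' : Finset α), #W' < #W → F'.IsGraphMarkOn c T' W' → 0 ≤ F'.ZP W' ∅ ∅ ∅)
include hc hF hIH

omit [Fintype α] in
/-- A MARKED point is a good coordinate (mechanism (A)). [this work] -/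
theorem marked_step {v : α} (hv : v ∈ W) (hTv : T v ≠ ∅) : 0 ≤ F.ZP W ∅ ∅ ∅ := by
  have hlab : F.lab {v} ≠ 0 := by
    rw [hF.lab_singleton hc.irrefl hv]
    exact theta_ne_zero _ hTv
  have h1 := F.ZP_le_ZP_insert_of_lab_singleton_ne_zero (W.erase v) v (notMem_erase v W) hlab
  rw [insert_erase hv] at h1
  have h0 := hIH F T (W.erase v) (card_erase_lt_of_mem hv) (hF.mono (erase_subset v W))
  linarith

/-- An unmarked point all of whose edges into `W` go to one point `u` (PENDANT, or isolated). [this work] -/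
theorem pendant_step {v : α} (hv : v ∈ W) (hTv : T v = ∅) (u : α) (hN : ∀ y ∈ W, y ≠ u → c v y = none) :
    0 ≤ F.ZP W ∅ ∅ ∅ := by
  have key : ∀ X ⊆ W.erase v, u ∉ X → F.lab (insert v X) = F.lab X := fun X hX huX => by
    rw [hF.lab_insert hc.symm hc.irrefl hv hTv (hX.trans (erase_subset v W)),
      nb_eq_empty (fun y hy => hN y (erase_subset v W (hX hy)) (fun h => huX (h ▸ hy))), theta_empty, joinM_zero_right]
  have h := F.ZP_insert_ge_of_pendant (W.erase v) v u (notMem_erase v W) key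
  rw [insert_erase hv] at h
  have h0 := hIH F T (W.erase v) (card_erase_lt_of_mem hv) (hF.mono (erase_subset v W))
  have h1 := hIH (F.con v) (addMarks c T v) (W.erase v) (card_erase_lt_of_mem hv)
    (hF.con hc.symm hc.irrefl hv hTv (erase_subset v W))
  linarith

/-- A RAINBOW TRIANGLE `p q t` (`p q` colour `0`, `p t` colour `1`, `q t` colour `2`) with `p, q` unmarked of degree `2` in `W`. [this work] -/
theorem triangle_step {p q t : α} (hp : p ∈ W) (hq : q ∈ W) (hTp : T p = ∅) (hTq : T q = ∅)
    (h0 : c p q = some 0) (h1 : c p t = some 1) (h2 : c q t = some 2)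
    (hNp : ∀ y ∈ W, y ≠ q → y ≠ t → c p y = none) (hNq : ∀ y ∈ W, y ≠ p → y ≠ t → c q y = none) :
    0 ≤ F.ZP W ∅ ∅ ∅ := by
  have hpq : p ≠ q := hc.ne_of_some h0
  have hpt : p ≠ t := hc.ne_of_some h1
  have hqt : q ≠ t := hc.ne_of_some h2
  set W' : Finset α := (W.erase p).erase q with hW'
  have hW'W : W' ⊆ W := (erase_subset _ _).trans (erase_subset _ _)
  have hpW' : p ∉ W' := fun h => (notMem_erase p W) (mem_of_mem_erase h)
  have hqW' : q ∉ W' := notMem_erase q _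
  have hq1 : q ∈ W.erase p := mem_erase.2 ⟨hpq.symm, hq⟩
  have hWeq : insert p (insert q W') = W := by rw [hW', insert_erase hq1, insert_erase hp]
  have hcard : #W' + 2 = #W := by
    rw [hW', card_erase_of_mem hq1, card_erase_of_mem hp]
    have := card_pos.2 ⟨p, hp⟩
    have : 1 < #W := by
      have h2le : #({p, q} : Finset α) ≤ #W := card_le_card (insert_subset hp (singleton_subset_iff.2 hq))
      rw [card_pair hpq] at h2le
      omega
    omega
  have hXW : ∀ X ⊆ W', X ⊆ W := fun X hX => hX.trans hW'W
  have hNpX : ∀ X ⊆ W', ∀ y ∈ X, y ≠ t → c p y = none := fun X hX y hy hyt =>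
    hNp y (hXW X hX hy) (fun h => hqW' (h ▸ hX hy)) hyt
  have hNqX : ∀ X ⊆ W', ∀ y ∈ X, y ≠ t → c q y = none := fun X hX y hy hyt =>
    hNq y (hXW X hX hy) (fun h => hpW' (h ▸ hX hy)) hyt
  have hP : ∀ X ⊆ W', F.lab (insert p X) = if t ∈ X then jn (F.lab X) 2 else F.lab X := by
    intro X hX
    rw [hF.lab_insert hc.symm hc.irrefl hp hTp (hXW X hX), nb_eq_ite h1 (hNpX X hX)]
    split_ifs
    · rw [theta_singleton, joinM_petalOf, petalOf_one]
    · rw [theta_empty, joinM_zero_right]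
  have hQ : ∀ X ⊆ W', F.lab (insert q X) = if t ∈ X then jn (F.lab X) 3 else F.lab X := by
    intro X hX
    rw [hF.lab_insert hc.symm hc.irrefl hq hTq (hXW X hX), nb_eq_ite h2 (hNqX X hX)]
    split_ifs
    · rw [theta_singleton, joinM_petalOf, petalOf_two]
    · rw [theta_empty, joinM_zero_right]
  have hPQ : ∀ X ⊆ W', F.lab (insert p (insert q X)) = if t ∈ X then 4 else jn (F.lab X) 1 := by
    intro X hX
    rw [hF.lab_insert hc.symm hc.irrefl hp hTp (insert_subset hq (hXW X hX)), nb_insert, h0, Option.toFinset_some,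
      nb_eq_ite h1 (hNpX X hX), hQ X hX]
    split_ifs
    · rw [theta_singleton_union_singleton 0 1 (by decide), joinM_four_right]
    · rw [union_empty, theta_singleton, joinM_petalOf, petalOf_zero]
  have hb := F.two_ZP_insert_insert_ge_of_triangleEdge W' hpq hpW' hqW' hP hQ hPQ
  rw [hWeq] at hb
  have m1 := hIH (F.con p) (addMarks c T p) W' (by omega) (hF.con hc.symm hc.irrefl hp hTp hW'W)
  have m2 := hIH (F.con q) (addMarks c T q) W' (by omega) (hF.con hc.symm hc.irrefl hq hTq hW'W)
  have m3 := hIH F T (insert q W') (by rw [card_insert_of_notMem hqW']; omega)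
    (hF.mono (insert_subset hq hW'W))
  linarith

end Steps

end Sunflower

end Summit.CriticalPhenomena.PercolationContinuityZ3.Theorems.SunflowerPartition
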